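import Summits.QuantumFields.QCD.Theorems.HeatSlicedQuarksQuarkLoopCoefficientSecondOrderExpansionAuxC

/-!
# Second-order expansion of the heat symbol — part D: the second-order Duhamel integrand
(line `Sketch` of crux stmt-QuantumFields-16786, stub `stub_secondOrderExpansion`, helper file)

The forcing of the second-order term, `F(r) = vtx 2 (pert0 r) + vtx 1 (pert1 r)`, as a finite combination
of the constant matrices `η'(v)`, `η(v)`, `1`, `η(v)η(u)` with explicit scalar coefficient functions, and
the collapse of each group under the free convolution `freeConv (s − r)` (semigroup law and the IBP
collapses of part C).  Notation (local): `η[v] = Σ_z (z∧v) • ď♯(z)ď(v−z)`, `η'[v] = Σ_z (z∧v)² • ď♯(z)ď(v−z)`.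
-/

noncomputable section

namespace Summit.QuantumFields.QCD.Cruxes.QuarkLoopCoefficient.Sketch.SecondOrderExpansion

open Literature.MathematicalPhysics.QuantumLattice Literature.MathematicalPhysics.QuantumFieldTheory
open Literature.Probability.LatticeModels (Site)
open Summit.QuantumFields.QCD.Theorems.QuarkLoopCoefficient
open Summit.QuantumFields.QCD.Cruxes.QuarkLoopCoefficient.Sketch.HeatSeries
open Summit.QuantumFields.QCD.Cruxes.QuarkLoopCoefficient.Sketch.FreeMajorantToolkit
open scoped Matrix ComplexConjugate

/-- The first-order matrix kernel `η(v) = Σ_{z ∈ nbr 0} (z∧v) • ď♯(z) ď(v−z)` (local notation). -/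
local notation "η[" v "]" => (∑ z ∈ nbr 0, ((wedge z v : ℤ) : ℂ) • (dsharp z * dsymb (v - z)))

/-- The second-order matrix kernel `η'(v) = Σ_{z ∈ nbr 0} (z∧v)² • ď♯(z) ď(v−z)` (local notation). -/
local notation "η'[" v "]" => (∑ z ∈ nbr 0, (((wedge z v : ℤ) : ℂ) ^ 2) • (dsharp z * dsymb (v - z)))

/-! ## §10 The forcing `F(r) = vtx 2 (E₀ r) + vtx 1 (E₁ r)` as a finite combination -/

/-- `vtx 2 (pert0 r) y = Σ_v (−k_r(y−v)/8) • η'(v) + Σ_v (−(v∧y) k_r(y−v)/4) • η(v) + (−(1/8) Σ_v (v∧y)² ĥ(v) k_r(y−v)) • 1`. -/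
theorem vtx_two_pert0_eq
    (h1 : ∀ x y : Site 4, sqKer (fun _ => (1 : ℂ)) x y = ((hhat (y - x) : ℝ) : ℂ) • (1 : Spin))
    (r : ℝ) (y : Site 4) :
    vtx 2 (pert0 r) y =
      ∑ v ∈ nbr2 0, (-1 / 8 * ((freeKer r (y - v) : ℝ) : ℂ)) • η'[v] +
        ∑ v ∈ nbr2 0, (-1 / 4 * ((wedge v y : ℤ) : ℂ) * ((freeKer r (y - v) : ℝ) : ℂ)) • η[v] +
        (∑ v ∈ nbr2 0, -1 / 8 * ((wedge v y : ℤ) : ℂ) ^ 2 * ((hhat v : ℝ) : ℂ) * ((freeKer r (y - v) : ℝ) : ℂ)) •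
          (1 : Spin) := by
  rw [vtx_two_apply]
  congr 1
  · congr 1
    · refine Finset.sum_congr rfl fun v _ => ?_
      rw [pert0, Matrix.mul_smul, Matrix.mul_one, smul_smul]
    · refine Finset.sum_congr rfl fun v _ => ?_
      rw [pert0, Matrix.mul_smul, Matrix.mul_one, smul_smul]
  · rw [Finset.sum_smul]
    refine Finset.sum_congr rfl fun v _ => ?_
    rw [pert0, h1, sub_zero, Matrix.smul_mul, Matrix.one_mul, smul_smul, smul_smul]

/-- `vtx 1 (pert1 r) y = Σ_{v,u} ((r/4) k_r(y−v−u)) • (η(v)η(u)) + Σ_{v,u} ((r/4)(v∧u) ĥ(v) k_r(y−v−u)) • η(u)`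
(the `v∧(y−u)` part of the Moyal weight drops out by the first Moyal cancellation at the point `y − u`). -/
theorem vtx_one_pert1_eq
    (h1 : ∀ x y : Site 4, sqKer (fun _ => (1 : ℂ)) x y = ((hhat (y - x) : ℝ) : ℂ) • (1 : Spin))
    (h3 : ∀ w : Site 4, freeKer 0 w = if w = 0 then 1 else 0)
    (h5 : ∀ s r : ℝ, 0 ≤ s → 0 ≤ r → ∀ w : Site 4,
      HasSum (fun y : Site 4 => freeKer s y * freeKer r (w - y)) (freeKer (s + r) w))
    (h6 : ∀ t : ℝ, 0 ≤ t → ∀ (w : Site 4) (ν : Fin 4),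
      t * (∑ z ∈ nbr2 0, ((z ν : ℤ) : ℝ) * hhat z * freeKer t (w - z)) + ((w ν : ℤ) : ℝ) * freeKer t w = 0)
    {r : ℝ} (hr : 0 ≤ r) (y : Site 4) :
    vtx 1 (pert1 r) y =
      ∑ v ∈ nbr2 0, ∑ u ∈ nbr2 0, ((r : ℂ) / 4 * ((freeKer r (y - v - u) : ℝ) : ℂ)) • (η[v] * η[u]) +
        ∑ v ∈ nbr2 0, ∑ u ∈ nbr2 0,
          ((r : ℂ) / 4 * ((wedge v u : ℤ) : ℂ) * ((hhat v : ℝ) : ℂ) * ((freeKer r (y - v - u) : ℝ) : ℂ)) • η[u] := by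
  rw [vtx_one_apply]
  have hp : ∀ x : Site 4, pert1 r x = -((r : ℂ) • ∑ u ∈ nbr2 0,
      (Complex.I / 2 * ((freeKer r (x - u) : ℝ) : ℂ)) • η[u]) := fun x => pert1_eq h1 h3 h5 h6 hr x
  congr 1
  · refine Finset.sum_congr rfl fun v _ => ?_
    rw [hp, Matrix.mul_neg, smul_neg, Matrix.mul_smul, smul_smul, Finset.mul_sum, Finset.smul_sum,
      ← Finset.sum_neg_distrib]
    refine Finset.sum_congr rfl fun u _ => ?_
    rw [Matrix.mul_smul, smul_smul, ← neg_smul]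
    congr 1
    have hI : Complex.I * Complex.I = -1 := Complex.I_mul_I
    linear_combination (-((r : ℂ) * ((freeKer r (y - v - u) : ℝ) : ℂ) / 4)) * hI
  · -- the Moyal weight `v∧y = v∧(y−u) + v∧u`; the first part cancels after summing over `v`
    have hterm : ∀ v ∈ nbr2 0, (Complex.I / 2 * ((wedge v y : ℤ) : ℂ)) •
        (sqKer (fun _ => (1 : ℂ)) 0 v * pert1 r (y - v)) =
        ∑ u ∈ nbr2 0, ((r : ℂ) / 4 * ((wedge v y : ℤ) : ℂ) * ((hhat v : ℝ) : ℂ) *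
            ((freeKer r (y - v - u) : ℝ) : ℂ)) • η[u] := by
      intro v _
      rw [h1, sub_zero, Matrix.smul_mul, Matrix.one_mul, hp, smul_neg, smul_neg, smul_smul, smul_smul,
        Finset.smul_sum, ← Finset.sum_neg_distrib]
      refine Finset.sum_congr rfl fun u _ => ?_
      rw [smul_smul, ← neg_smul]
      congr 1
      have hI : Complex.I * Complex.I = -1 := Complex.I_mul_I
      linear_combination (-((r : ℂ) / 4 * ((wedge v y : ℤ) : ℂ) * ((hhat v : ℝ) : ℂ) *
        ((freeKer r (y - v - u) : ℝ) : ℂ))) * hI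
    have hw : ∀ v u : Site 4, ((wedge v y : ℤ) : ℂ) = ((wedge v (y - u) : ℤ) : ℂ) + ((wedge v u : ℤ) : ℂ) := by
      intro v u
      rw [← Int.cast_add, ← wedge_add_right, sub_add_cancel]
    have hzero : ∑ v ∈ nbr2 0, ∑ u ∈ nbr2 0, ((r : ℂ) / 4 * ((wedge v (y - u) : ℤ) : ℂ) * ((hhat v : ℝ) : ℂ) *
        ((freeKer r (y - v - u) : ℝ) : ℂ)) • η[u] = 0 := by
      rw [Finset.sum_comm]
      refine Finset.sum_eq_zero fun u _ => ?_
      rw [← Finset.sum_smul]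
      have h := sum_wedge_mul_hhat_mul_freeKer_eq_zero h3 h6 hr (y - u)
      have : ∑ v ∈ nbr2 0, (r : ℂ) / 4 * ((wedge v (y - u) : ℤ) : ℂ) * ((hhat v : ℝ) : ℂ) *
          ((freeKer r (y - v - u) : ℝ) : ℂ) =
          (r : ℂ) / 4 * (((∑ v ∈ nbr2 0, ((wedge v (y - u) : ℤ) : ℝ) * hhat v * freeKer r (y - u - v) : ℝ)) : ℂ) := by
        rw [Complex.ofReal_sum, Finset.mul_sum]
        refine Finset.sum_congr rfl fun v _ => ?_
        rw [sub_right_comm y v u]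
        push_cast; ring
      rw [this, h]
      simp
    calc ∑ v ∈ nbr2 0, (Complex.I / 2 * ((wedge v y : ℤ) : ℂ)) • (sqKer (fun _ => (1 : ℂ)) 0 v * pert1 r (y - v))
        = ∑ v ∈ nbr2 0, ∑ u ∈ nbr2 0, ((r : ℂ) / 4 * ((wedge v y : ℤ) : ℂ) * ((hhat v : ℝ) : ℂ) *
            ((freeKer r (y - v - u) : ℝ) : ℂ)) • η[u] := Finset.sum_congr rfl hterm
      _ = ∑ v ∈ nbr2 0, ∑ u ∈ nbr2 0,
            (((r : ℂ) / 4 * ((wedge v (y - u) : ℤ) : ℂ) * ((hhat v : ℝ) : ℂ) * ((freeKer r (y - v - u) : ℝ) : ℂ)) • η[u] +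
              ((r : ℂ) / 4 * ((wedge v u : ℤ) : ℂ) * ((hhat v : ℝ) : ℂ) * ((freeKer r (y - v - u) : ℝ) : ℂ)) • η[u]) := by
          refine Finset.sum_congr rfl fun v _ => Finset.sum_congr rfl fun u _ => ?_
          rw [← add_smul]
          congr 1
          rw [hw v u]; ring
      _ = ∑ v ∈ nbr2 0, ∑ u ∈ nbr2 0,
            ((r : ℂ) / 4 * ((wedge v (y - u) : ℤ) : ℂ) * ((hhat v : ℝ) : ℂ) * ((freeKer r (y - v - u) : ℝ) : ℂ)) • η[u] +
          ∑ v ∈ nbr2 0, ∑ u ∈ nbr2 0,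
            ((r : ℂ) / 4 * ((wedge v u : ℤ) : ℂ) * ((hhat v : ℝ) : ℂ) * ((freeKer r (y - v - u) : ℝ) : ℂ)) • η[u] := by
          rw [← Finset.sum_add_distrib]
          exact Finset.sum_congr rfl fun v _ => Finset.sum_add_distrib
      _ = _ := by rw [hzero, zero_add]

/-! ## §11 Collapse of the groups under `freeConv (s − r)` -/

/-- `freeConv` of a scalar coefficient function times a constant matrix. -/
theorem freeConv_smul_const (c : Site 4 → ℂ) (M : Spin) (t : ℝ) (w : Site 4)
    (hc : Summable (fun y : Site 4 => ((freeKer t (w - y) : ℝ) : ℂ) * c y)) :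
    freeConv t (fun y => c y • M) w = (∑' y : Site 4, ((freeKer t (w - y) : ℝ) : ℂ) * c y) • M := by
  have := freeConv_finset_sum_smul (Finset.univ : Finset Unit) (fun _ => c) (fun _ => M) t w (fun _ _ => hc)
  simpa using this

/-- Group 1 (`η'`): `freeConv (s−r) [y ↦ Σ_v (−k_r(y−v)/8) • η'(v)] w = Σ_v (−k_s(w−v)/8) • η'(v)`. -/
theorem freeConv_group_one
    (h5 : ∀ s r : ℝ, 0 ≤ s → 0 ≤ r → ∀ w : Site 4,
      HasSum (fun y : Site 4 => freeKer s y * freeKer r (w - y)) (freeKer (s + r) w))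
    {s r : ℝ} (hr : 0 ≤ r) (hrs : r ≤ s) (w : Site 4) :
    freeConv (s - r) (fun y => ∑ v ∈ nbr2 0, (-1 / 8 * ((freeKer r (y - v) : ℝ) : ℂ)) • η'[v]) w =
      ∑ v ∈ nbr2 0, (-1 / 8 * ((freeKer s (w - v) : ℝ) : ℂ)) • η'[v] := by
  have hsr : 0 ≤ s - r := sub_nonneg.mpr hrs
  have hS : ∀ v : Site 4, HasSum (fun y : Site 4 => freeKer (s - r) (w - y) * freeKer r (y - v))
      (freeKer s (w - v)) := by
    intro v
    have := hasSum_freeKer_mul_freeKer h5 hsr hr w v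
    rwa [sub_add_cancel] at this
  have hsum : ∀ v : Site 4, Summable (fun y : Site 4 =>
      ((freeKer (s - r) (w - y) : ℝ) : ℂ) * (-1 / 8 * ((freeKer r (y - v) : ℝ) : ℂ))) := fun v =>
    ((summable_ofReal_mul_of_hasSum (s - r) w (hS v)).mul_left (-1 / 8)).congr fun y => by ring
  rw [freeConv_finset_sum_smul (nbr2 0) (fun v y => -1 / 8 * ((freeKer r (y - v) : ℝ) : ℂ)) _ (s - r) w
    (fun v _ => hsum v)]
  refine Finset.sum_congr rfl fun v _ => ?_
  congr 1
  have e : ∀ y : Site 4, ((freeKer (s - r) (w - y) : ℝ) : ℂ) * (-1 / 8 * ((freeKer r (y - v) : ℝ) : ℂ)) =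
      -1 / 8 * (((freeKer (s - r) (w - y) : ℝ) : ℂ) * ((freeKer r (y - v) : ℝ) : ℂ)) := fun y => by ring
  simp_rw [e]
  rw [tsum_mul_left, tsum_ofReal_mul_of_hasSum (s - r) w (hS v)]

/-- The Moyal weight in shifted coordinates: `v∧y = v₀ (y−v)₁ − v₁ (y−v)₀` (real form). -/
theorem cast_wedge_eq_sub (v y : Site 4) :
    ((wedge v y : ℤ) : ℝ) = ((v 0 : ℤ) : ℝ) * (((y - v) 1 : ℤ) : ℝ) - ((v 1 : ℤ) : ℝ) * (((y - v) 0 : ℤ) : ℝ) := by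
  rw [← wedge_sub_self_right v y, cast_wedge]

/-- Group 2 (`η`, one Moyal weight): real `HasSum` of the coefficient,
`Σ_y k_{s−r}(w−y) (v∧y) k_r(y−v) = (r/s) (v∧w) k_s(w−v)`. -/
theorem hasSum_group_two_coeff
    (h5 : ∀ s r : ℝ, 0 ≤ s → 0 ≤ r → ∀ w : Site 4,
      HasSum (fun y : Site 4 => freeKer s y * freeKer r (w - y)) (freeKer (s + r) w))
    (h6 : ∀ t : ℝ, 0 ≤ t → ∀ (w : Site 4) (ν : Fin 4),
      t * (∑ z ∈ nbr2 0, ((z ν : ℤ) : ℝ) * hhat z * freeKer t (w - z)) + ((w ν : ℤ) : ℝ) * freeKer t w = 0)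
    {s r : ℝ} (hs : 0 < s) (hr : 0 ≤ r) (hrs : r ≤ s) (w v : Site 4) :
    HasSum (fun y : Site 4 => freeKer (s - r) (w - y) * (((wedge v y : ℤ) : ℝ) * freeKer r (y - v)))
      (r / s * (((wedge v w : ℤ) : ℝ) * freeKer s (w - v))) := by
  have hsr : 0 ≤ s - r := sub_nonneg.mpr hrs
  have hab : 0 < s - r + r := by linarith
  have h0 := hasSum_freeKer_mul_coord_mul_freeKer h5 h6 hsr hr hab w v 0
  have h1 := hasSum_freeKer_mul_coord_mul_freeKer h5 h6 hsr hr hab w v 1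
  rw [sub_add_cancel] at h0 h1
  have h := (h1.mul_left (((v 0 : ℤ) : ℝ))).sub (h0.mul_left (((v 1 : ℤ) : ℝ)))
  have hv : ((v 0 : ℤ) : ℝ) * (r / s * ((((w - v) 1 : ℤ) : ℝ) * freeKer s (w - v))) -
      ((v 1 : ℤ) : ℝ) * (r / s * ((((w - v) 0 : ℤ) : ℝ) * freeKer s (w - v))) =
      r / s * (((wedge v w : ℤ) : ℝ) * freeKer s (w - v)) := by
    rw [cast_wedge_eq_sub v w]; ring
  rw [hv] at h
  refine h.congr_fun fun y => ?_
  rw [cast_wedge_eq_sub v y]; ring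

/-- Group 2 (`η`): `freeConv (s−r) [y ↦ Σ_v (−(v∧y) k_r(y−v)/4) • η(v)] w = Σ_v (−(r/s)(v∧w) k_s(w−v)/4) • η(v)`. -/
theorem freeConv_group_two
    (h5 : ∀ s r : ℝ, 0 ≤ s → 0 ≤ r → ∀ w : Site 4,
      HasSum (fun y : Site 4 => freeKer s y * freeKer r (w - y)) (freeKer (s + r) w))
    (h6 : ∀ t : ℝ, 0 ≤ t → ∀ (w : Site 4) (ν : Fin 4),
      t * (∑ z ∈ nbr2 0, ((z ν : ℤ) : ℝ) * hhat z * freeKer t (w - z)) + ((w ν : ℤ) : ℝ) * freeKer t w = 0)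
    {s r : ℝ} (hs : 0 < s) (hr : 0 ≤ r) (hrs : r ≤ s) (w : Site 4) :
    freeConv (s - r) (fun y => ∑ v ∈ nbr2 0,
        (-1 / 4 * ((wedge v y : ℤ) : ℂ) * ((freeKer r (y - v) : ℝ) : ℂ)) • η[v]) w =
      ∑ v ∈ nbr2 0, (-1 / 4 * ((r : ℂ) / (s : ℂ)) * ((wedge v w : ℤ) : ℂ) * ((freeKer s (w - v) : ℝ) : ℂ)) • η[v] := by
  have hS := fun v => hasSum_group_two_coeff h5 h6 hs hr hrs w v
  have hsum : ∀ v : Site 4, Summable (fun y : Site 4 => ((freeKer (s - r) (w - y) : ℝ) : ℂ) *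
      (-1 / 4 * ((wedge v y : ℤ) : ℂ) * ((freeKer r (y - v) : ℝ) : ℂ))) := fun v =>
    ((summable_ofReal_mul_of_hasSum (s - r) w (hS v)).mul_left (-1 / 4)).congr fun y => by push_cast; ring
  rw [freeConv_finset_sum_smul (nbr2 0)
    (fun v y => -1 / 4 * ((wedge v y : ℤ) : ℂ) * ((freeKer r (y - v) : ℝ) : ℂ)) _ (s - r) w (fun v _ => hsum v)]
  refine Finset.sum_congr rfl fun v _ => ?_
  congr 1
  have e : ∀ y : Site 4, ((freeKer (s - r) (w - y) : ℝ) : ℂ) *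
      (-1 / 4 * ((wedge v y : ℤ) : ℂ) * ((freeKer r (y - v) : ℝ) : ℂ)) =
      -1 / 4 * (((freeKer (s - r) (w - y) : ℝ) : ℂ) *
        (((((wedge v y : ℤ) : ℝ) * freeKer r (y - v) : ℝ)) : ℂ)) := fun y => by push_cast; ring
  simp_rw [e]
  rw [tsum_mul_left, tsum_ofReal_mul_of_hasSum (s - r) w (hS v)]
  push_cast; ring

/-- Group 3 (`1`, two Moyal weights): real `HasSum` of the coefficient,
`Σ_y k_{s−r}(w−y) (v∧y)² k_r(y−v) = (r/s)² (v∧w)² k_s(w−v) − (r(s−r)/s) [v₀²G₁₁ − 2v₀v₁G₀₁ + v₁²G₀₀](s, w−v)`. -/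
theorem hasSum_group_three_coeff
    (h5 : ∀ s r : ℝ, 0 ≤ s → 0 ≤ r → ∀ w : Site 4,
      HasSum (fun y : Site 4 => freeKer s y * freeKer r (w - y)) (freeKer (s + r) w))
    (h6 : ∀ t : ℝ, 0 ≤ t → ∀ (w : Site 4) (ν : Fin 4),
      t * (∑ z ∈ nbr2 0, ((z ν : ℤ) : ℝ) * hhat z * freeKer t (w - z)) + ((w ν : ℤ) : ℝ) * freeKer t w = 0)
    {s r : ℝ} (hs : 0 < s) (hr : 0 ≤ r) (hrs : r ≤ s) (w v : Site 4) :
    HasSum (fun y : Site 4 => freeKer (s - r) (w - y) * (((wedge v y : ℤ) : ℝ) ^ 2 * freeKer r (y - v)))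
      ((r / s) ^ 2 * (((wedge v w : ℤ) : ℝ) ^ 2 * freeKer s (w - v)) -
        (s - r) * r / s *
          (((v 0 : ℤ) : ℝ) ^ 2 * ∑ z ∈ nbr2 0, ((z 1 : ℤ) : ℝ) * ((z 1 : ℤ) : ℝ) * hhat z * freeKer s (w - v - z) -
            2 * ((v 0 : ℤ) : ℝ) * ((v 1 : ℤ) : ℝ) *
              ∑ z ∈ nbr2 0, ((z 0 : ℤ) : ℝ) * ((z 1 : ℤ) : ℝ) * hhat z * freeKer s (w - v - z) +
            ((v 1 : ℤ) : ℝ) ^ 2 * ∑ z ∈ nbr2 0, ((z 0 : ℤ) : ℝ) * ((z 0 : ℤ) : ℝ) * hhat z * freeKer s (w - v - z))) := by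
  have hsr : 0 ≤ s - r := sub_nonneg.mpr hrs
  have hab : 0 < s - r + r := by linarith
  have h11 := hasSum_freeKer_mul_coord_mul_coord_mul_freeKer h5 h6 hsr hr hab w v 1 1
  have h01 := hasSum_freeKer_mul_coord_mul_coord_mul_freeKer h5 h6 hsr hr hab w v 0 1
  have h00 := hasSum_freeKer_mul_coord_mul_coord_mul_freeKer h5 h6 hsr hr hab w v 0 0
  rw [sub_add_cancel] at h11 h01 h00
  have h := ((h11.mul_left (((v 0 : ℤ) : ℝ) ^ 2)).sub (h01.mul_left (2 * ((v 0 : ℤ) : ℝ) * ((v 1 : ℤ) : ℝ)))).add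
    (h00.mul_left (((v 1 : ℤ) : ℝ) ^ 2))
  have hs' : (s : ℝ) ≠ 0 := hs.ne'
  have key : HasSum (fun y : Site 4 => freeKer (s - r) (w - y) * (((wedge v y : ℤ) : ℝ) ^ 2 * freeKer r (y - v)))
      (((v 0 : ℤ) : ℝ) ^ 2 * ((r / s) ^ 2 * ((((w - v) 1 : ℤ) : ℝ) * (((w - v) 1 : ℤ) : ℝ) * freeKer s (w - v)) -
          (s - r) * r / s * ∑ z ∈ nbr2 0, ((z 1 : ℤ) : ℝ) * ((z 1 : ℤ) : ℝ) * hhat z * freeKer s (w - v - z)) -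
        2 * ((v 0 : ℤ) : ℝ) * ((v 1 : ℤ) : ℝ) * ((r / s) ^ 2 * ((((w - v) 0 : ℤ) : ℝ) * (((w - v) 1 : ℤ) : ℝ) *
          freeKer s (w - v)) -
          (s - r) * r / s * ∑ z ∈ nbr2 0, ((z 0 : ℤ) : ℝ) * ((z 1 : ℤ) : ℝ) * hhat z * freeKer s (w - v - z)) +
        ((v 1 : ℤ) : ℝ) ^ 2 * ((r / s) ^ 2 * ((((w - v) 0 : ℤ) : ℝ) * (((w - v) 0 : ℤ) : ℝ) * freeKer s (w - v)) -
          (s - r) * r / s * ∑ z ∈ nbr2 0, ((z 0 : ℤ) : ℝ) * ((z 0 : ℤ) : ℝ) * hhat z * freeKer s (w - v - z))) :=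
    h.congr_fun fun y => by rw [cast_wedge_eq_sub v y]; ring
  have hv : ((v 0 : ℤ) : ℝ) ^ 2 * ((r / s) ^ 2 * ((((w - v) 1 : ℤ) : ℝ) * (((w - v) 1 : ℤ) : ℝ) * freeKer s (w - v)) -
          (s - r) * r / s * ∑ z ∈ nbr2 0, ((z 1 : ℤ) : ℝ) * ((z 1 : ℤ) : ℝ) * hhat z * freeKer s (w - v - z)) -
        2 * ((v 0 : ℤ) : ℝ) * ((v 1 : ℤ) : ℝ) * ((r / s) ^ 2 * ((((w - v) 0 : ℤ) : ℝ) * (((w - v) 1 : ℤ) : ℝ) *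
          freeKer s (w - v)) -
          (s - r) * r / s * ∑ z ∈ nbr2 0, ((z 0 : ℤ) : ℝ) * ((z 1 : ℤ) : ℝ) * hhat z * freeKer s (w - v - z)) +
        ((v 1 : ℤ) : ℝ) ^ 2 * ((r / s) ^ 2 * ((((w - v) 0 : ℤ) : ℝ) * (((w - v) 0 : ℤ) : ℝ) * freeKer s (w - v)) -
          (s - r) * r / s * ∑ z ∈ nbr2 0, ((z 0 : ℤ) : ℝ) * ((z 0 : ℤ) : ℝ) * hhat z * freeKer s (w - v - z)) =
      (r / s) ^ 2 * (((wedge v w : ℤ) : ℝ) ^ 2 * freeKer s (w - v)) -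
        (s - r) * r / s *
          (((v 0 : ℤ) : ℝ) ^ 2 * ∑ z ∈ nbr2 0, ((z 1 : ℤ) : ℝ) * ((z 1 : ℤ) : ℝ) * hhat z * freeKer s (w - v - z) -
            2 * ((v 0 : ℤ) : ℝ) * ((v 1 : ℤ) : ℝ) *
              ∑ z ∈ nbr2 0, ((z 0 : ℤ) : ℝ) * ((z 1 : ℤ) : ℝ) * hhat z * freeKer s (w - v - z) +
            ((v 1 : ℤ) : ℝ) ^ 2 * ∑ z ∈ nbr2 0, ((z 0 : ℤ) : ℝ) * ((z 0 : ℤ) : ℝ) * hhat z * freeKer s (w - v - z)) := by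
    rw [cast_wedge_eq_sub v w]
    field_simp
    ring
  rw [hv] at key
  exact key

/-- Group 3 (`1`): the collapsed coefficient of the identity matrix. -/
theorem freeConv_group_three
    (h5 : ∀ s r : ℝ, 0 ≤ s → 0 ≤ r → ∀ w : Site 4,
      HasSum (fun y : Site 4 => freeKer s y * freeKer r (w - y)) (freeKer (s + r) w))
    (h6 : ∀ t : ℝ, 0 ≤ t → ∀ (w : Site 4) (ν : Fin 4),
      t * (∑ z ∈ nbr2 0, ((z ν : ℤ) : ℝ) * hhat z * freeKer t (w - z)) + ((w ν : ℤ) : ℝ) * freeKer t w = 0)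
    {s r : ℝ} (hs : 0 < s) (hr : 0 ≤ r) (hrs : r ≤ s) (w : Site 4) :
    freeConv (s - r) (fun y => (∑ v ∈ nbr2 0, -1 / 8 * ((wedge v y : ℤ) : ℂ) ^ 2 * ((hhat v : ℝ) : ℂ) *
        ((freeKer r (y - v) : ℝ) : ℂ)) • (1 : Spin)) w =
      (((∑ v ∈ nbr2 0, -1 / 8 * hhat v * ((r / s) ^ 2 * (((wedge v w : ℤ) : ℝ) ^ 2 * freeKer s (w - v)) -
        (s - r) * r / s *
          (((v 0 : ℤ) : ℝ) ^ 2 * ∑ z ∈ nbr2 0, ((z 1 : ℤ) : ℝ) * ((z 1 : ℤ) : ℝ) * hhat z * freeKer s (w - v - z) -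
            2 * ((v 0 : ℤ) : ℝ) * ((v 1 : ℤ) : ℝ) *
              ∑ z ∈ nbr2 0, ((z 0 : ℤ) : ℝ) * ((z 1 : ℤ) : ℝ) * hhat z * freeKer s (w - v - z) +
            ((v 1 : ℤ) : ℝ) ^ 2 * ∑ z ∈ nbr2 0, ((z 0 : ℤ) : ℝ) * ((z 0 : ℤ) : ℝ) * hhat z * freeKer s (w - v - z))) :
          ℝ)) : ℂ) • (1 : Spin) := by
  have hS := fun v => hasSum_group_three_coeff h5 h6 hs hr hrs w v
  -- the real coefficient series
  have hreal : HasSum (fun y : Site 4 => freeKer (s - r) (w - y) * ∑ v ∈ nbr2 0,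
      -1 / 8 * hhat v * (((wedge v y : ℤ) : ℝ) ^ 2 * freeKer r (y - v))) _ :=
    (hasSum_sum fun v (_ : v ∈ nbr2 0) => (hS v).mul_left (-1 / 8 * hhat v)).congr_fun fun y => by
      rw [Finset.mul_sum]
      refine Finset.sum_congr rfl fun v _ => ?_
      ring
  have hsum : Summable (fun y : Site 4 => ((freeKer (s - r) (w - y) : ℝ) : ℂ) *
      ∑ v ∈ nbr2 0, -1 / 8 * ((wedge v y : ℤ) : ℂ) ^ 2 * ((hhat v : ℝ) : ℂ) * ((freeKer r (y - v) : ℝ) : ℂ)) := by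
    refine (summable_ofReal_mul_of_hasSum (s - r) w hreal).congr fun y => ?_
    push_cast
    congr 1
    refine Finset.sum_congr rfl fun v _ => ?_
    ring
  rw [freeConv_smul_const _ (1 : Spin) (s - r) w hsum]
  congr 1
  rw [← tsum_ofReal_mul_of_hasSum (s - r) w hreal]
  refine tsum_congr fun y => ?_
  push_cast
  congr 1
  refine Finset.sum_congr rfl fun v _ => ?_
  ring

/-- Groups 4 and 5 (`η(v)η(u)` and `η(u)` with a `y`-independent weight): the double-shift semigroup law,
`Σ_y k_{s−r}(w−y) (c k_r(y−v−u)) = c k_s(w−v−u)`, in the form consumed by `freeConv_finset_sum_smul` on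
the product index set. -/
theorem freeConv_group_double
    (h5 : ∀ s r : ℝ, 0 ≤ s → 0 ≤ r → ∀ w : Site 4,
      HasSum (fun y : Site 4 => freeKer s y * freeKer r (w - y)) (freeKer (s + r) w))
    {s r : ℝ} (hr : 0 ≤ r) (hrs : r ≤ s) (w : Site 4) (c : Site 4 → Site 4 → ℂ) (M : Site 4 → Site 4 → Spin) :
    freeConv (s - r) (fun y => ∑ v ∈ nbr2 0, ∑ u ∈ nbr2 0,
        (c v u * ((freeKer r (y - v - u) : ℝ) : ℂ)) • M v u) w =
      ∑ v ∈ nbr2 0, ∑ u ∈ nbr2 0, (c v u * ((freeKer s (w - v - u) : ℝ) : ℂ)) • M v u := by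
  have hsr : 0 ≤ s - r := sub_nonneg.mpr hrs
  have hS : ∀ v u : Site 4, HasSum (fun y : Site 4 => freeKer (s - r) (w - y) * freeKer r (y - v - u))
      (freeKer s (w - v - u)) := by
    intro v u
    have := hasSum_freeKer_mul_freeKer h5 hsr hr w (v + u)
    rw [sub_add_cancel, ← sub_sub] at this
    exact this.congr_fun fun y => by rw [sub_sub]
  have hsum : ∀ p : Site 4 × Site 4, Summable (fun y : Site 4 => ((freeKer (s - r) (w - y) : ℝ) : ℂ) *
      (c p.1 p.2 * ((freeKer r (y - p.1 - p.2) : ℝ) : ℂ))) := fun p =>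
    ((summable_ofReal_mul_of_hasSum (s - r) w (hS p.1 p.2)).mul_left (c p.1 p.2)).congr fun y => by ring
  have e1 : (fun y => ∑ v ∈ nbr2 0, ∑ u ∈ nbr2 0, (c v u * ((freeKer r (y - v - u) : ℝ) : ℂ)) • M v u) =
      fun y => ∑ p ∈ nbr2 0 ×ˢ nbr2 0, (c p.1 p.2 * ((freeKer r (y - p.1 - p.2) : ℝ) : ℂ)) • M p.1 p.2 := by
    funext y; rw [Finset.sum_product]
  rw [e1, freeConv_finset_sum_smul (nbr2 0 ×ˢ nbr2 0)
    (fun p y => c p.1 p.2 * ((freeKer r (y - p.1 - p.2) : ℝ) : ℂ)) (fun p => M p.1 p.2) (s - r) w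
    (fun p _ => hsum p), Finset.sum_product]
  refine Finset.sum_congr rfl fun v _ => Finset.sum_congr rfl fun u _ => ?_
  congr 1
  have e : ∀ y : Site 4, ((freeKer (s - r) (w - y) : ℝ) : ℂ) * (c v u * ((freeKer r (y - v - u) : ℝ) : ℂ)) =
      c v u * (((freeKer (s - r) (w - y) : ℝ) : ℂ) * ((freeKer r (y - v - u) : ℝ) : ℂ)) := fun y => by ring
  simp_rw [e]
  rw [tsum_mul_left, tsum_ofReal_mul_of_hasSum (s - r) w (hS v u)]

/-! ## Registered headline -/

/-- Registered headline of this helper file (aux stub `stub_secondOrderExpansionAuxD` of crux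
stmt-QuantumFields-16786, line `Sketch`): the second-order vertex on the free kernel. -/
theorem stub_secondOrderExpansionAuxD : (∀ x y : Site 4, sqKer (fun _ => (1 : ℂ)) x y = ((hhat (y - x) : ℝ) : ℂ) • (1 : Spin)) → ∀ (r : ℝ) (y : Site 4), vtx 2 (pert0 r) y = ∑ v ∈ nbr2 0, (-1 / 8 * ((freeKer r (y - v) : ℝ) : ℂ)) • (∑ z ∈ nbr 0, (((wedge z v : ℤ) : ℂ) ^ 2) • (dsharp z * dsymb (v - z))) + ∑ v ∈ nbr2 0, (-1 / 4 * ((wedge v y : ℤ) : ℂ) * ((freeKer r (y - v) : ℝ) : ℂ)) • (∑ z ∈ nbr 0, ((wedge z v : ℤ) : ℂ) • (dsharp z * dsymb (v - z))) + (∑ v ∈ nbr2 0, -1 / 8 * ((wedge v y : ℤ) : ℂ) ^ 2 * ((hhat v : ℝ) : ℂ) * ((freeKer r (y - v) : ℝ) : ℂ)) • (1 : Spin) :=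
  fun h1 r y => vtx_two_pert0_eq h1 r y

end Summit.QuantumFields.QCD.Cruxes.QuarkLoopCoefficient.Sketch.SecondOrderExpansion

end
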